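import Literature.AlgebraicGeometry.Villamayor2007.DegreePreserving
import Mathlib.RingTheory.Polynomial.Basic
import HarnessLib

/-!
# Villamayor 2007, 1.15 / Thm. 1.16 (ii): the INPUT «`Q` a `b`-fold point» in ideal form — `f ∈ (I, Z − s)^b`
# iff the coefficients of `f(Z₁ + s)` satisfy `c_i ∈ I^i` — and the resulting `I_r(f) ⊆ I^r`, PROVED

O. E. Villamayor U., *Hypersurface singularities in positive characteristic*, Adv. Math. **213** (2007)
687–733 = arXiv:math/0606796 [Villamayor2007]; locators «p00NN Lnn» = chunk · line of the held arXiv text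
(`lit read paper:arxiv-math_0606796`, chunk p0009 re-read before typing). Sequel of `DegreePreserving.lean`
(`elimIdeal_le_pow_of_taylor`: if `c = coeffVec b (taylor s (monicOf a))` has `c_i ∈ I^i` then `I_r ⊆ I^r`).
Campaign `res-hironaka` (D-0089), ladder rung LIT-6. PROOF file: theorems only, no definitions, no named facts;
nothing of Hironaka's 2017 manuscript is referred to.

## What is proved

1.15 p0009 L27–L34 derives, at a `b`-fold point `Q` of the hypersurface `{f = 0} ⊂ Spec(S[Z])` lying over the
closed point of the regular local ring `(S, M)`, «a suitable change of coordinate `Z₁ = Z − s`, `s ∈ S`, so that: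
`f(Z) = Z₁^b + c₁Z₁^{b−1} + … + c_{b−1}Z₁ + c_b ∈ S[Z]`, and `ν_S(c_i) ≥ i`» (from Zariski's multiplicity formula,
which supplies `s` with `Q = (M, Z − s)`). The step from «`f` has multiplicity `b` at `Q = (M, Z − s)`», i.e.
`f ∈ Q^b = (M·S[Z] + (Z − s))^b`, to «`ν_S(c_i) ≥ i`» is the elementary identity proved here for ANY ideal `I`
of ANY commutative ring `S`:

* `coeff_mem_pow_of_mem_pow_sup_span_X` / `mem_pow_sup_span_X_iff`: `g ∈ (I·S[Z] + (Z))^n` iff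
  `coeff_m g ∈ I^{n−m}` for every `m` (truncated subtraction: no condition for `m ≥ n`);
* `taylor_mem_pow_sup_span_X_of_mem` : `f ∈ (I·S[Z] + (Z − s))^n ⟹ f(Z + s) ∈ (I·S[Z] + (Z))^n`;
* hence the usable form of **Thm. 1.16 (ii)** (its printed proof 1.15, with the Zariski input replaced by the
  ideal-theoretic multiplicity hypothesis): `elimIdeal_le_pow_of_mem_pow` — if `monicOf a ∈ (I·S[Z] + (Z − s))^b`
  for some `s ∈ S`, then `I_r(f) ⊆ I^r` for every `r` (for `(S, M)` regular local and `I = M`: `ν_S(I_r) ≥ r`,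
  «`ν_S(G_{b,i}(a₁,…,a_b)) ≥ n_i`», p0009 L67–L71), and the same for `ℋ_f` and for an arbitrary monic `f`.

What is still NOT here: that a point of multiplicity `b` of the hypersurface is RATIONAL over `S` in the `Z`-direction
(`Q = (M, Z − s)` for some `s ∈ S` — «the residue fields of the local rings `B` and `S` are the same», p0009 L35–L38,
Zariski–Samuel VIII §10 Cor. 1); consumers supply `s`.

## References

* O. E. Villamayor U., Adv. Math. 213 (2007) 687–733 = arXiv:math/0606796: 1.15, Thm. 1.16 (ii). [Villamayor2007]
-/

noncomputable section

open scoped Polynomial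

namespace Literature.AlgebraicGeometry.Villamayor2007

open MvPolynomial

universe u v w

/-! ## `(I·S[Z] + (Z))^n` coefficientwise -/

section PowSup

variable {S : Type w} [CommRing S]

/-- Coefficients of a product: if `coeff_i h ∈ I^{n−i}` for all `i` and all coefficients of `p` lie in `I`, then
`coeff_m (h·p) ∈ I^{n+1−m}`. [cite: Villamayor2007, 1.15 p0009 L27–L34] -/
theorem coeff_mul_mem_pow_of_coeff_mem (I : Ideal S) {n : ℕ} {h p : S[X]} (hh : ∀ i, h.coeff i ∈ I ^ (n - i))
    (hp : ∀ j, p.coeff j ∈ I) (m : ℕ) : (h * p).coeff m ∈ I ^ (n + 1 - m) := by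
  rw [Polynomial.coeff_mul]
  refine Ideal.sum_mem _ fun ij hij => ?_
  have hle : ij.1 ≤ m := by
    rw [Finset.mem_antidiagonal] at hij
    omega
  have h1 : h.coeff ij.1 * p.coeff ij.2 ∈ I ^ (n - ij.1 + 1) := by
    rw [pow_succ]
    exact Ideal.mul_mem_mul (hh ij.1) (hp ij.2)
  exact Ideal.pow_le_pow_right (by omega) h1

/-- Coefficients of a product with `Z`: if `coeff_i h ∈ I^{n−i}` for all `i`, then `coeff_m (h·t·Z) ∈ I^{n+1−m}`.
[cite: Villamayor2007, 1.15 p0009 L27–L34] -/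
theorem coeff_mul_mul_X_mem_pow_of_coeff_mem (I : Ideal S) {n : ℕ} {h : S[X]} (hh : ∀ i, h.coeff i ∈ I ^ (n - i))
    (t : S[X]) (m : ℕ) : (h * (t * Polynomial.X)).coeff m ∈ I ^ (n + 1 - m) := by
  rw [← mul_assoc]
  rcases Nat.eq_zero_or_pos m with hm | hm
  · subst hm
    rw [Polynomial.mul_coeff_zero, Polynomial.coeff_X_zero, mul_zero]
    exact Ideal.zero_mem _
  · obtain ⟨m', rfl⟩ : ∃ m', m = m' + 1 := ⟨m - 1, by omega⟩
    rw [Polynomial.coeff_mul_X, Polynomial.coeff_mul]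
    refine Ideal.sum_mem _ fun ij hij => ?_
    have hle : ij.1 ≤ m' := by
      rw [Finset.mem_antidiagonal] at hij
      omega
    exact Ideal.pow_le_pow_right (by omega) (Ideal.mul_mem_right _ _ (hh ij.1))

/-- **`g ∈ (I·S[Z] + (Z))^n ⟹ coeff_m g ∈ I^{n−m}`** — the passage «`f(Z) = Z₁^b + c₁Z₁^{b−1} + … + c_b` … and
`ν_S(c_i) ≥ i`» at a `b`-fold point `Q = (M, Z₁)` (p0009 L32–L34), for any ideal `I` in place of `M`.
[cite: Villamayor2007, 1.15 p0009 L27–L34] -/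
theorem coeff_mem_pow_of_mem_pow_sup_span_X (I : Ideal S) :
    ∀ {n : ℕ} {g : S[X]}, g ∈ (I.map (Polynomial.C : S →+* S[X]) ⊔ Ideal.span {Polynomial.X}) ^ n →
      ∀ m : ℕ, g.coeff m ∈ I ^ (n - m)
  | 0, g, _, m => by
    rw [Nat.zero_sub, pow_zero, Ideal.one_eq_top]
    exact Submodule.mem_top
  | n + 1, g, hg, m => by
    rw [pow_succ] at hg
    refine Submodule.mul_induction_on hg (fun h hh q hq => ?_) (fun x y hx hy => ?_)
    · -- `h ∈ J^n`, `q ∈ J = I·S[Z] + (Z)`: `q = p + t·Z` with `p ∈ I·S[Z]`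
      have ih : ∀ i, h.coeff i ∈ I ^ (n - i) := coeff_mem_pow_of_mem_pow_sup_span_X I hh
      obtain ⟨p, hp, q', hq', rfl⟩ := Submodule.mem_sup.mp hq
      obtain ⟨t, rfl⟩ := Ideal.mem_span_singleton'.mp hq'
      rw [mul_add, Polynomial.coeff_add]
      exact Ideal.add_mem _ (coeff_mul_mem_pow_of_coeff_mem I ih (Ideal.mem_map_C_iff.mp hp) m)
        (coeff_mul_mul_X_mem_pow_of_coeff_mem I ih t m)
    · rw [Polynomial.coeff_add]
      exact Ideal.add_mem _ hx hy

/-- Conversely, `coeff_m g ∈ I^{n−m}` for all `m` ⟹ `g ∈ (I·S[Z] + (Z))^n` (each monomial `c Z^m`, `c ∈ I^{n−m}`,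
lies in `(I·S[Z])^{n−m}·(Z)^m ⊆ (I·S[Z] + (Z))^n`). [cite: Villamayor2007, 1.15 p0009 L27–L34] -/
theorem mem_pow_sup_span_X_of_coeff_mem_pow (I : Ideal S) {n : ℕ} {g : S[X]}
    (hg : ∀ m : ℕ, g.coeff m ∈ I ^ (n - m)) :
    g ∈ (I.map (Polynomial.C : S →+* S[X]) ⊔ Ideal.span {Polynomial.X}) ^ n := by
  have hterm : ∀ m : ℕ, Polynomial.C (g.coeff m) * Polynomial.X ^ m ∈
      (I.map (Polynomial.C : S →+* S[X]) ⊔ Ideal.span {Polynomial.X}) ^ n := by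
    intro m
    have hC : Polynomial.C (g.coeff m) ∈
        (I.map (Polynomial.C : S →+* S[X]) ⊔ Ideal.span {Polynomial.X}) ^ (n - m) := by
      have h1 : Polynomial.C (g.coeff m) ∈ (I.map (Polynomial.C : S →+* S[X])) ^ (n - m) := by
        rw [← Ideal.map_pow]
        exact Ideal.mem_map_of_mem _ (hg m)
      exact Ideal.pow_right_mono le_sup_left (n - m) h1
    have hX : (Polynomial.X : S[X]) ^ m ∈ (I.map (Polynomial.C : S →+* S[X]) ⊔ Ideal.span {Polynomial.X}) ^ m :=
      Ideal.pow_right_mono le_sup_right m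
        (Ideal.pow_mem_pow (Ideal.subset_span (Set.mem_singleton Polynomial.X)) m)
    have hmul := Ideal.mul_mem_mul hC hX
    rw [← pow_add] at hmul
    exact Ideal.pow_le_pow_right (by omega) hmul
  have hsum := Ideal.sum_mem ((I.map (Polynomial.C : S →+* S[X]) ⊔ Ideal.span {Polynomial.X}) ^ n)
    (fun m (_ : m ∈ Finset.range (g.natDegree + 1)) => hterm m)
  rwa [← Polynomial.as_sum_range_C_mul_X_pow g] at hsum

/-- **`g ∈ (I·S[Z] + (Z))^n` iff `coeff_m g ∈ I^{n−m}` for all `m`.** [cite: Villamayor2007, 1.15 p0009 L27–L34] -/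
theorem mem_pow_sup_span_X_iff (I : Ideal S) {n : ℕ} {g : S[X]} :
    g ∈ (I.map (Polynomial.C : S →+* S[X]) ⊔ Ideal.span {Polynomial.X}) ^ n ↔
      ∀ m : ℕ, g.coeff m ∈ I ^ (n - m) :=
  ⟨fun hg => coeff_mem_pow_of_mem_pow_sup_span_X I hg, mem_pow_sup_span_X_of_coeff_mem_pow I⟩

/-- The change `Z₁ = Z − s` carries `(I·S[Z] + (Z − s))` onto `(I·S[Z₁] + (Z₁))`: if `f ∈ (I·S[Z] + (Z − s))^n` then
`f(Z₁ + s) = taylor s f ∈ (I·S[Z₁] + (Z₁))^n` («a suitable change of coordinate `Z₁ = Z − s`», p0009 L32–L33).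
[cite: Villamayor2007, 1.15 p0009 L27–L34] -/
theorem taylor_mem_pow_sup_span_X_of_mem (I : Ideal S) (s : S) {n : ℕ} {f : S[X]}
    (hf : f ∈ (I.map (Polynomial.C : S →+* S[X]) ⊔ Ideal.span {Polynomial.X - Polynomial.C s}) ^ n) :
    Polynomial.taylor s f ∈ (I.map (Polynomial.C : S →+* S[X]) ⊔ Ideal.span {Polynomial.X}) ^ n := by
  have h := Ideal.mem_map_of_mem ((Polynomial.taylorAlgHom s : S[X] →ₐ[S] S[X]) : S[X] →+* S[X]) hf
  rw [Ideal.map_pow, Ideal.map_sup, Ideal.map_map, Ideal.map_span, Set.image_singleton] at h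
  have hC : ((Polynomial.taylorAlgHom s : S[X] →ₐ[S] S[X]) : S[X] →+* S[X]).comp Polynomial.C =
      (Polynomial.C : S →+* S[X]) := by
    ext x
    simp
  have hX : ((Polynomial.taylorAlgHom s : S[X] →ₐ[S] S[X]) : S[X] →+* S[X]) (Polynomial.X - Polynomial.C s) =
      Polynomial.X := by
    simp
  rw [hC, hX] at h
  exact h

end PowSup

/-! ## Thm. 1.16 (ii) from the ideal-theoretic multiplicity hypothesis -/

section Multiplicity

variable {k : Type v} [CommRing k] {S : Type w} [CommRing S] [Algebra k S] {b : ℕ}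

/-- **Thm. 1.16 (ii), usable form** [Villamayor 2007, Thm. 1.16 (ii) p0009 L65–L71 «If `R` is regular, and `Q ∈
V(⟨f(Z)⟩)` is a point of multiplicity `b` of this hypersurface in `Spec(R[Z])`, then `ν_S(G_{b,i}(a₁,…,a_b)) ≥ n_i`
… where `S = R_P`, `P = π(Q)`», proof 1.15 p0009 L27–L53]: if `f = monicOf a ∈ (I·S[Z] + (Z − s))^b` for some
`s ∈ S` (multiplicity `b` along the section `Z = s` over `V(I)`; for `(S, M)` local and `I = M` this is `f ∈ Q^b`,
`Q = (M, Z − s)` the `S`-rational point of the fibre), then `I_r(f) ⊆ I^r` for every `r`. The rationality of a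
`b`-fold point (existence of `s`, Zariski's multiplicity formula) is the consumer's input.
[cite: Villamayor2007, Thm. 1.16 (ii) p0009 L65–L71] -/
theorem elimIdeal_le_pow_of_mem_pow (I : Ideal S) (a : Fin b → S) (s : S)
    (hf : monicOf a ∈ (I.map (Polynomial.C : S →+* S[X]) ⊔ Ideal.span {Polynomial.X - Polynomial.C s}) ^ b)
    (r : ℕ) : elimIdeal k a r ≤ I ^ r := by
  refine elimIdeal_le_pow_of_taylor I a s (fun i => ?_) r
  have h := coeff_mem_pow_of_mem_pow_sup_span_X I (taylor_mem_pow_sup_span_X_of_mem I s hf) (b - 1 - (i : ℕ))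
  have hi : (i : ℕ) < b := i.2
  have hexp : b - (b - 1 - (i : ℕ)) = (i : ℕ) + 1 := by omega
  rw [hexp] at h
  exact h

/-- `ℋ_f`-version of Thm. 1.16 (ii): `I^{(2)}_r(f) ⊆ I^r`. [cite: Villamayor2007, Thm. 1.16 (ii) p0009 L65–L71] -/
theorem hElimIdeal_le_pow_of_mem_pow (I : Ideal S) (a : Fin b → S) (s : S)
    (hf : monicOf a ∈ (I.map (Polynomial.C : S →+* S[X]) ⊔ Ideal.span {Polynomial.X - Polynomial.C s}) ^ b)
    (r : ℕ) : hElimIdeal k a r ≤ I ^ r :=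
  (hElimIdeal_le_elimIdeal a r).trans (elimIdeal_le_pow_of_mem_pow I a s hf r)

/-- Thm. 1.16 (ii) for an arbitrary monic `f ∈ S[Z]` of degree `b`: `f ∈ (I·S[Z] + (Z − s))^b ⟹ I_r(f) ⊆ I^r`.
[cite: Villamayor2007, Thm. 1.16 (ii) p0009 L65–L71] -/
theorem elimIdeal_le_pow_of_mem_pow_of_monic (I : Ideal S) {f : S[X]} (hmonic : f.Monic) (hdeg : f.natDegree = b)
    (s : S) (hf : f ∈ (I.map (Polynomial.C : S →+* S[X]) ⊔ Ideal.span {Polynomial.X - Polynomial.C s}) ^ b)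
    (r : ℕ) : elimIdeal k (coeffVec b f) r ≤ I ^ r :=
  elimIdeal_le_pow_of_mem_pow I (coeffVec b f) s (by rwa [monicOf_coeffVec hmonic hdeg]) r

end Multiplicity

end Literature.AlgebraicGeometry.Villamayor2007

end
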